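import Mathlib
import Literature.AlgebraicGeometry.Resolution.BlowupPrincipalCharts
import Literature.AlgebraicGeometry.Resolution.IdealSheafLemmas
import Literature.AlgebraicGeometry.Resolution.MarkedIdealsLemmas
import Summits.ResolutionOfSingularities.ResolutionOfSingularities.Theorems.WildQuotientsWildQuotientResolutionToricExitChartStable
import Summits.ResolutionOfSingularities.ResolutionOfSingularities.Theorems.WildQuotientsWildQuotientResolutionToricExitJordanThreeBrickNonempty
import HarnessLib

/-!
# The Rees charts `D₊(bt)` of an affine blowing up ARE its principal charts; stability of charts and of basic opens of invariant sections

(crux stmt-ResolutionOfSingularities-15640 `WildQuotients.WildQuotientResolution`, line `Sketch`,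
sector `|G| = p`; programme V4U of `L/w45c/CHAIN.md` v6 §4 row stub-2, T2 (c) «σ̃-stability of
`D₊(T't)` and `W_T`»; [OURS · L1 W4.5c] — generic scheme glue, NOT a statement of any manuscript.)

For `V = Bl_I(Spec R) = Proj R[It]` (`affineBlowup I`) and `b ∈ I`, the Rees chart
`D₊(bt) = chartι_b(Spec (R[It])_{(bt)})` (`affineBlowup.chartOpen`, Literature `AffineBlowupCartier`) and
the intrinsic principal chart `V[⊤, b]` (`blowupChart`, Literature `BlowupPrincipalCharts`: the largest
open on which `π^*b` is a regular generator of `I·𝒪_V`) coincide: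
`blowupChart_affineBlowup_eq_chartOpen` / `…_eq_basicOpen_reesT` (the chart is principal:
`BlowupExit.affineBlowup_chartOpen_le_blowupChart`, res-L1-w45c-stub-5; conversely a principal chart
lifts INTO `D₊(bt)` by `affineBlowup.exists_lift_preimage_basicOpen_eq_top` and the uniqueness of morphisms
to a blowing up). Consequences for a group acting on `Spec R` with `I` stable and the lifted action on `V`
(`IsBlowup.liftAction`): the Rees chart at an INVARIANT `b ∈ I` is stable
(`preimage_basicOpen_reesT_eq_self_of_action`, from `ToricExit.preimage_blowupChart_eq_self_of_action`,
p488231); pulled-back invariant functions are invariant sections on a stable open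
(`appLE_pull_eq_self_of_action`); and the basic open of an invariant section of a stable open is stable
(`preimage_basicOpen_eq_self_of_appLE_eq`). V4U use: `D₊(T't)` and `W_T = D₊(T't) ∩ D(θ)`,
`θ = H'³/T'²`, are `σ̃`-stable in `Bl_{I₆} 𝔸ⁿ` (`T'`, `H'` are `J₄`-invariant).
-/

-- single-problem summit: the doubled namespace component `ResolutionOfSingularities` is forced
set_option linter.dupNamespace false

noncomputable section

open CategoryTheory AlgebraicGeometry TopologicalSpace HomogeneousLocalization
open Literature.AlgebraicGeometry.Resolution

namespace Summit.ResolutionOfSingularities.ResolutionOfSingularities.Theorems.WildQuotientResolution.ToricExit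

universe u

section Bridge

variable {R : Type u} [CommRing R] {I : Ideal R}

/-- **The principal chart `V[⊤, b]` of the affine blowing up is the Rees chart `D₊(bt)`.** A principal
chart `W` lifts into `D₊(bt)` (`affineBlowup.exists_lift_preimage_basicOpen_eq_top` applied to
`W ↪ V → Spec R`, along which `I` becomes generated by the non-zero-divisor `π^*b|_W`), and the lift is
the inclusion by the uniqueness of morphisms to a blowing up. [cite: GortzWedhorn2020, Prop. 13.92 (proof, p. 415)] -/
theorem blowupChart_affineBlowup_eq_chartOpen (b : R) (hb : b ∈ I) :
    blowupChart (affineBlowup.π I) (affineBlowup.idealSheaf I) ⟨⊤, isAffineOpen_top _⟩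
        ((Scheme.ΓSpecIso (.of R)).inv b) =
      (affineBlowup.chartOpen b hb : (affineBlowup I).Opens) := by
  refine le_antisymm (iSup_le fun W => ?_) (BlowupExit.affineBlowup_chartOpen_le_blowupChart b hb)
  obtain ⟨W, h, hnzd, hideal⟩ := W
  -- notation
  let X' := affineBlowup I
  let p := affineBlowup.π I
  let 𝓘 := affineBlowup.idealSheaf I
  let ι₀ : R →+* Γ(Spec (.of R), ⊤) := (Scheme.ΓSpecIso (.of R)).inv.hom
  haveI : IsAffine (W : Scheme.{u}) := W.2
  let q : (W : Scheme.{u}) ⟶ Spec (.of R) := (W : X'.Opens).ι ≫ p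
  -- the ideal sheaf of `I` pulls back along `q` to `I·𝒪_{X'}|_W`, an effective Cartier divisor
  have hcart : IsEffectiveCartier (𝓘.comap ((W : X'.Opens).ι ≫ p)) := by
    rw [Scheme.IdealSheafData.comap_comp]
    exact (affineBlowup.isBlowup I).isEffectiveCartier.comap_ι _
  -- the regular generator `u = π^*b|_W` of `I·Γ(W, 𝒪_W)`
  let β : Γ(X', W) := p.appLE ⊤ W h (ι₀ b)
  let t : Γ(X', W) ≅ Γ((W : X'.Opens), ⊤) := (W : X'.Opens).topIso.symm
  have htop : (⊤ : (W : Scheme.{u}).Opens) ≤ q ⁻¹ᵁ ⊤ := le_top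
  have e₃ : (⊤ : (W : Scheme.{u}).Opens) ≤ (W : X'.Opens).ι ⁻¹ᵁ (W : X'.Opens) := fun x _ => x.2
  have a1 : q.appTop = q.appLE ⊤ ⊤ htop := by
    rw [Scheme.Hom.appTop, Scheme.Hom.app_eq_appLE]
    rfl
  have e1 : q.appTop = p.appLE ⊤ W h ≫ t.hom :=
    calc q.appTop = q.appLE ⊤ ⊤ htop := a1
      _ = p.appLE ⊤ W h ≫ (W : X'.Opens).ι.appLE W ⊤ e₃ :=
          (Scheme.Hom.appLE_comp_appLE _ _ _ _ _ _ _).symm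
      _ = p.appLE ⊤ W h ≫ t.hom := by rw [ι_appLE_eq_topIso_inv]; rfl
  have hqapp : ∀ s : R, q.appTop.hom (ι₀ s) = t.hom.hom (p.appLE ⊤ W h (ι₀ s)) := by
    intro s
    rw [e1]
    rfl
  have hu : t.hom.hom β ∈ nonZeroDivisors _ :=
    mem_nonZeroDivisors_of_inverse t.hom.hom t.inv.hom (fun a => by
      rw [← CommRingCat.comp_apply, t.hom_inv_id]; rfl) (fun a => by
      rw [← CommRingCat.comp_apply, t.inv_hom_id]; rfl) hnzd
  have hIdeal : 𝓘.ideal ⟨⊤, isAffineOpen_top _⟩ = I.map ι₀ := by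
    change (Scheme.IdealSheafData.ofIdealTop _).ideal ⟨⊤, isAffineOpen_top _⟩ = _
    rw [ideal_ofIdealTop_top]
  have hIu : I.map (q.appTop.hom.comp ι₀) = Ideal.span {t.hom.hom β} := by
    have : q.appTop.hom.comp ι₀ = t.hom.hom.comp ((p.appLE ⊤ W h).hom.comp ι₀) := RingHom.ext hqapp
    rw [this, ← Ideal.map_map, ← Ideal.map_map, ← hIdeal, ← ideal_comap_of_le p 𝓘 _ W h, hideal,
      Ideal.map_span, Set.image_singleton]
  -- the chart lift into `D₊(bt)` coincides with the inclusion `W ↪ X'`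
  obtain ⟨l, hl, hltop⟩ := affineBlowup.exists_lift_preimage_basicOpen_eq_top (I := I) q hu hIu
    b hb (hqapp b)
  have hlw : l = (W : X'.Opens).ι :=
    (affineBlowup.isBlowup I).hom_ext (by rw [hl]; exact hcart) hl
  -- hence `W ⊆ D₊(bt)`
  intro x hx
  have hmem : (⟨x, hx⟩ : (W : X'.Opens)) ∈ l ⁻¹ᵁ Proj.basicOpen (reesGrading I) (reesT b hb) := by
    rw [hltop]; trivial
  rw [hlw] at hmem
  change x ∈ ((affineBlowup.chartOpen b hb : (affineBlowup I).Opens) : Set (affineBlowup I))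
  rw [show (affineBlowup.chartOpen b hb : (affineBlowup I).Opens) =
      Proj.basicOpen (reesGrading I) (reesT b hb) from affineBlowup.image_top_chartι b hb]
  exact hmem

/-- The principal chart `V[⊤, b]` of `Bl_I(Spec R)` is the basic open `D₊(bt)` of `Proj R[It]`.
[cite: StacksProject, Tag 0804] -/
theorem blowupChart_affineBlowup_eq_basicOpen_reesT (b : R) (hb : b ∈ I) :
    blowupChart (affineBlowup.π I) (affineBlowup.idealSheaf I) ⟨⊤, isAffineOpen_top _⟩
        ((Scheme.ΓSpecIso (.of R)).inv b) =
      Proj.basicOpen (reesGrading I) (reesT b hb) := by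
  rw [blowupChart_affineBlowup_eq_chartOpen]
  exact affineBlowup.image_top_chartι b hb

/-- `b/1 ∈ Γ(Spec R, ⊤)` lies in the top ideal of the ideal sheaf of `I` when `b ∈ I`. [folklore] -/
theorem ΓSpecIso_inv_mem_idealSheaf_ideal_top (b : R) (hb : b ∈ I) :
    (Scheme.ΓSpecIso (.of R)).inv b ∈ (affineBlowup.idealSheaf I).ideal ⟨⊤, isAffineOpen_top _⟩ := by
  change _ ∈ (Scheme.IdealSheafData.ofIdealTop _).ideal ⟨⊤, isAffineOpen_top _⟩
  rw [ideal_ofIdealTop_top]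
  exact Ideal.mem_map_of_mem _ hb

end Bridge

section Action

variable {R : Type u} [CommRing R] {I : Ideal R} {G : Type*} [Group G]
  (ρ : G →* Aut (Spec (CommRingCat.of R))) (ρ' : G →* Aut (affineBlowup I))
  (hequiv : ∀ g : G, (ρ' g).hom ≫ affineBlowup.π I = affineBlowup.π I ≫ (ρ g).hom)

include hequiv in
/-- **The Rees chart `D₊(bt)` at an invariant `b ∈ I` is stable** under any action on `Bl_I(Spec R)`
lifting an `I`-preserving action on `Spec R` (e.g. `IsBlowup.liftAction`): the principal chart is
intrinsic (`ToricExit.preimage_blowupChart_eq_self_of_action`) and equals `D₊(bt)`. [folklore] -/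
theorem preimage_basicOpen_reesT_eq_self_of_action
    (hI : ∀ g : G, (affineBlowup.idealSheaf I).comap (ρ g).hom = affineBlowup.idealSheaf I)
    {b : R} (hb : b ∈ I)
    (hfix : ∀ g : G, (ρ g).hom.appTop ((Scheme.ΓSpecIso (.of R)).inv b) = (Scheme.ΓSpecIso (.of R)).inv b)
    (g : G) :
    (ρ' g).hom ⁻¹ᵁ Proj.basicOpen (reesGrading I) (reesT b hb) = Proj.basicOpen (reesGrading I) (reesT b hb) := by
  rw [← blowupChart_affineBlowup_eq_basicOpen_reesT b hb]
  exact preimage_blowupChart_eq_self_of_action (affineBlowup.isBlowup I) ρ ρ' hequiv hI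
    (ΓSpecIso_inv_mem_idealSheaf_ideal_top b hb) hfix g

include hequiv in
/-- **Pulled-back invariant functions are invariant sections on a stable open**: if `U ⊆ Bl_I(Spec R)`
is stable under `g` and `F ∈ R` is fixed by `g` downstairs, then `(ρ' g)^*` fixes the pull-back of `F`
to `U`. [folklore] -/
theorem appLE_pull_eq_self_of_action (U : (affineBlowup I).Opens) (g : G) (hU : (ρ' g).hom ⁻¹ᵁ U = U)
    (F : R) (hF : (ρ g).hom.appTop ((Scheme.ΓSpecIso (.of R)).inv F) = (Scheme.ΓSpecIso (.of R)).inv F) :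
    (ρ' g).hom.appLE U U hU.ge (affineBlowup.pull I U F) = affineBlowup.pull I U F := by
  have e₂ : U ≤ affineBlowup.π I ⁻¹ᵁ ((ρ g).hom ⁻¹ᵁ (⊤ : (Spec (CommRingCat.of R)).Opens)) := le_top
  change (ρ' g).hom.appLE U U hU.ge ((affineBlowup.π I).appLE ⊤ U le_top _) = _
  rw [← CommRingCat.comp_apply, Scheme.Hom.appLE_comp_appLE, appLE_congr_hom (hequiv g),
    ← Scheme.Hom.appLE_comp_appLE (affineBlowup.π I) (ρ g).hom ⊤ ((ρ g).hom ⁻¹ᵁ ⊤) U le_rfl e₂,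
    CommRingCat.comp_apply, Scheme.Hom.appLE_eq_app]
  change (affineBlowup.π I).appLE _ U e₂ ((ρ g).hom.appTop ((Scheme.ΓSpecIso (.of R)).inv F)) = _
  rw [hF]
  rfl

omit hequiv in
/-- **The basic open of an invariant section of a stable open is stable.** [folklore] -/
theorem preimage_basicOpen_eq_self_of_appLE_eq {X : Scheme.{u}} (α : X ⟶ X) (U : X.Opens)
    (hU : α ⁻¹ᵁ U = U) (s : Γ(X, U)) (hs : α.appLE U U hU.ge s = s) :
    α ⁻¹ᵁ X.basicOpen s = X.basicOpen s := by
  have h := Scheme.basicOpen_appLE α U U hU.ge s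
  rw [hs] at h
  have hle : α ⁻¹ᵁ X.basicOpen s ≤ U := fun x hx => by
    rw [← hU]; exact X.basicOpen_le s hx
  conv_rhs => rw [h]
  exact (inf_eq_right.mpr hle).symm

end Action

end Summit.ResolutionOfSingularities.ResolutionOfSingularities.Theorems.WildQuotientResolution.ToricExit

end
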